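import Summits.Ventures.HodgeRepro2.T5HeckeTranspose

/-!
# The `∗`-algebra structure of `H(G, K)`: `f^*(g) = \overline{f(g⁻¹)}`

Over a field with a star operation (`ℂ` with complex conjugation), the Hecke algebra is a
`∗`-algebra for `f^*(g) := \overline{f(g⁻¹)}`.  In the Haar-free model this is the composite of
the coefficientwise conjugation `conj` (`t ↦ \bar t`) and the transpose of `T5HeckeTranspose`:

* `conj` is additive, conjugate-linear, involutive, multiplicative for the convolution
  (`conj_conv`: the structure constants are integers), preserves `K`-invariance and the double
  cosets, and commutes with the transpose;
* on `H(G, K)`: `conjOp` is a ring endomorphism fixing every `T_g`, `starOp := transposeOp ∘ conjOp`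
  is an involutive conjugate-linear anti-automorphism with `starOp T_g = T_{g⁻¹}`, and
  `starRing hK : StarRing (H(G, K))` packages it as Mathlib's `StarRing`.
-/

namespace Summit.Ventures.HodgeRepro2.T5HeckeStar

open T5HeckePermutationModule T5HeckeDoubleCoset T5HeckeDoubleCosetBasis T5HeckeConvolution
  T5HeckeTranspose LevelPositivity

variable {G : Type*} [Group G] {k : Type*} [Field k] [StarRing k] {K : Subgroup G}

section Conj

/-- Coefficientwise conjugation `t ↦ \bar t` on `k[G/K]`. -/
noncomputable def conj (t : MonoidAlgebra k (G ⧸ K)) : MonoidAlgebra k (G ⧸ K) :=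
  MonoidAlgebra.ofCoeff (Finsupp.mapRange star (star_zero k) t.coeff)

/-- The coefficients of `\bar t`. -/
theorem coeff_conj (t : MonoidAlgebra k (G ⧸ K)) (x : G ⧸ K) :
    (conj t).coeff x = star (t.coeff x) := by
  unfold conj
  rw [MonoidAlgebra.coeff_ofCoeff, Finsupp.mapRange_apply]

/-- `conj` is involutive. -/
theorem conj_conj (t : MonoidAlgebra k (G ⧸ K)) : conj (conj t) = t := by
  apply MonoidAlgebra.ext
  ext x
  rw [coeff_conj, coeff_conj, star_star]

/-- `conj` is additive. -/
theorem conj_add (t s : MonoidAlgebra k (G ⧸ K)) : conj (t + s) = conj t + conj s := by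
  apply MonoidAlgebra.ext
  ext x
  rw [MonoidAlgebra.coeff_add, Finsupp.add_apply, coeff_conj, coeff_conj, coeff_conj,
    MonoidAlgebra.coeff_add, Finsupp.add_apply, star_add]

/-- `conj` is conjugate-linear. -/
theorem conj_smul (c : k) (t : MonoidAlgebra k (G ⧸ K)) : conj (c • t) = star c • conj t := by
  apply MonoidAlgebra.ext
  ext x
  rw [MonoidAlgebra.coeff_smul, Finsupp.smul_apply, coeff_conj, coeff_conj, MonoidAlgebra.coeff_smul,
    Finsupp.smul_apply, smul_eq_mul, smul_eq_mul, star_mul']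

/-- `conj 0 = 0`. -/
theorem conj_zero : conj (0 : MonoidAlgebra k (G ⧸ K)) = 0 := by
  apply MonoidAlgebra.ext
  ext x
  rw [coeff_conj, MonoidAlgebra.coeff_zero, Finsupp.zero_apply, star_zero]

/-- `conj` preserves `K`-invariance. -/
theorem conj_mem_invariants {t : MonoidAlgebra k (G ⧸ K)}
    (ht : t ∈ invariants (Representation.ofMulAction k G (G ⧸ K)) K) :
    conj t ∈ invariants (Representation.ofMulAction k G (G ⧸ K)) K := by
  rw [mem_invariants_ofMulAction_iff] at ht ⊢
  intro κ hκ x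
  rw [coeff_conj, coeff_conj, ht κ hκ x]

/-- `conj` fixes `δ_K`. -/
theorem conj_single_one :
    conj (MonoidAlgebra.single ((1 : G) : G ⧸ K) (1 : k)) =
      MonoidAlgebra.single ((1 : G) : G ⧸ K) (1 : k) := by
  classical
  apply MonoidAlgebra.ext
  ext x
  rw [coeff_conj, MonoidAlgebra.coeff_single, Finsupp.single_apply]
  split_ifs <;> simp only [star_one, star_zero]

/-- `conj` fixes the characteristic function of a finite set of cosets. -/
theorem conj_orbitVector {O : Set (G ⧸ K)} (hO : O.Finite) :
    conj (orbitVector k K O) = orbitVector k K O := by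
  classical
  apply MonoidAlgebra.ext
  ext x
  rw [coeff_conj, coeff_orbitVector_eq_ite hO]
  split_ifs <;> simp only [star_one, star_zero]

/-- `conj` is multiplicative for the convolution (the structure constants are integers). -/
theorem conj_conv (t s : MonoidAlgebra k (G ⧸ K)) : conj (conv t s) = conv (conj t) (conj s) := by
  apply MonoidAlgebra.ext
  ext z
  rw [coeff_conj, coeff_conv, coeff_conv]
  unfold conj
  rw [MonoidAlgebra.coeff_ofCoeff, Finsupp.sum_mapRange_index (fun x => by rw [zero_mul]),
    ← starRingEnd_apply, map_finsuppSum]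
  refine Finsupp.sum_congr fun x _ => ?_
  rw [starRingEnd_apply, star_mul', MonoidAlgebra.coeff_ofCoeff, Finsupp.mapRange_apply]

/-- `conj` commutes with the transpose. -/
theorem conj_transpose (hK : ∀ g : G, Finite (MulAction.orbit K (g : G ⧸ K)))
    (t : MonoidAlgebra k (G ⧸ K)) : conj (transpose hK t) = transpose hK (conj t) := by
  apply MonoidAlgebra.ext
  ext x
  rw [coeff_conj, coeff_transpose, coeff_transpose, coeff_conj]

end Conj

section ConjOp

/-- Coefficientwise conjugation on `H(G, K)`, through `H(G, K) ≃ k[G/K]^K`. -/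
noncomputable def conjOp (T : heckeAlgebra k K) : heckeAlgebra k K :=
  heckeAlgebraEquivInvariants.symm
    ⟨conj (heckeAlgebraEquivInvariants T), conj_mem_invariants (Subtype.coe_prop _)⟩

/-- `(conjOp T)(δ_K) = \overline{T δ_K}`. -/
theorem conjOp_apply_single_one (T : heckeAlgebra k K) :
    (conjOp T : Module.End k (MonoidAlgebra k (G ⧸ K)))
        (MonoidAlgebra.single ((1 : G) : G ⧸ K) (1 : k)) =
      conj ((T : Module.End k (MonoidAlgebra k (G ⧸ K)))
        (MonoidAlgebra.single ((1 : G) : G ⧸ K) (1 : k))) := by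
  rw [← heckeAlgebraEquivInvariants_apply, conjOp, LinearEquiv.apply_symm_apply]
  show conj (heckeAlgebraEquivInvariants T : MonoidAlgebra k (G ⧸ K)) = _
  rw [heckeAlgebraEquivInvariants_apply]

/-- `conjOp` is multiplicative. -/
theorem conjOp_mul (T S : heckeAlgebra k K) : conjOp (T * S) = conjOp T * conjOp S := by
  apply ext_of_apply_single_one
  rw [conjOp_apply_single_one, mul_apply_single_one_eq_conv, mul_apply_single_one_eq_conv,
    conjOp_apply_single_one, conjOp_apply_single_one, conj_conv]

/-- `conjOp 1 = 1`. -/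
theorem conjOp_one : conjOp (1 : heckeAlgebra k K) = 1 := by
  apply ext_of_apply_single_one
  rw [conjOp_apply_single_one, one_apply_single_one, conj_single_one]

/-- `conjOp` is additive. -/
theorem conjOp_add (T S : heckeAlgebra k K) : conjOp (T + S) = conjOp T + conjOp S := by
  apply ext_of_apply_single_one
  rw [conjOp_apply_single_one, Subalgebra.coe_add, LinearMap.add_apply, conj_add,
    Subalgebra.coe_add, LinearMap.add_apply, conjOp_apply_single_one, conjOp_apply_single_one]

/-- `conjOp` is conjugate-linear. -/
theorem conjOp_smul (c : k) (T : heckeAlgebra k K) : conjOp (c • T) = star c • conjOp T := by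
  apply ext_of_apply_single_one
  rw [conjOp_apply_single_one, Subalgebra.coe_smul, LinearMap.smul_apply, conj_smul,
    Subalgebra.coe_smul, LinearMap.smul_apply, conjOp_apply_single_one]

/-- `conjOp` is involutive. -/
theorem conjOp_conjOp (T : heckeAlgebra k K) : conjOp (conjOp T) = T := by
  apply ext_of_apply_single_one
  rw [conjOp_apply_single_one, conjOp_apply_single_one, conj_conj]

/-- `conjOp` fixes every double-coset operator (their coefficients are `0` and `1`). -/
theorem conjOp_doubleCosetOp (g : G) [Finite (MulAction.orbit K (g : G ⧸ K))] :
    conjOp (doubleCosetOp k K g) = doubleCosetOp k K g := by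
  apply ext_of_apply_single_one
  rw [conjOp_apply_single_one, doubleCosetOp_apply_single_one, conj_orbitVector (Set.toFinite _)]

/-- `conjOp` commutes with `transposeOp`. -/
theorem conjOp_transposeOp (hK : ∀ g : G, Finite (MulAction.orbit K (g : G ⧸ K)))
    (T : heckeAlgebra k K) : conjOp (transposeOp hK T) = transposeOp hK (conjOp T) := by
  apply ext_of_apply_single_one
  rw [conjOp_apply_single_one, transposeOp_apply_single_one, transposeOp_apply_single_one,
    conjOp_apply_single_one, conj_transpose]

end ConjOp

section Star

variable (hK : ∀ g : G, Finite (MulAction.orbit K (g : G ⧸ K)))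

/-- THE STAR OPERATION `T^* := \overline{T}^∨` of `H(G, K)` (`f^*(g) = \overline{f(g⁻¹)}`). -/
noncomputable def starOp (T : heckeAlgebra k K) : heckeAlgebra k K :=
  transposeOp hK (conjOp T)

/-- `(T^*)(δ_K) = (\overline{T δ_K})^∨`. -/
theorem starOp_apply_single_one (T : heckeAlgebra k K) :
    (starOp hK T : Module.End k (MonoidAlgebra k (G ⧸ K)))
        (MonoidAlgebra.single ((1 : G) : G ⧸ K) (1 : k)) =
      transpose hK (conj ((T : Module.End k (MonoidAlgebra k (G ⧸ K)))
        (MonoidAlgebra.single ((1 : G) : G ⧸ K) (1 : k)))) := by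
  rw [starOp, transposeOp_apply_single_one, conjOp_apply_single_one]

/-- `(T S)^* = S^* T^*`. -/
theorem starOp_mul (T S : heckeAlgebra k K) : starOp hK (T * S) = starOp hK S * starOp hK T := by
  rw [starOp, starOp, starOp, conjOp_mul, transposeOp_mul]

/-- `1^* = 1`. -/
theorem starOp_one : starOp hK (1 : heckeAlgebra k K) = 1 := by
  rw [starOp, conjOp_one, transposeOp_one]

/-- `(T + S)^* = T^* + S^*`. -/
theorem starOp_add (T S : heckeAlgebra k K) : starOp hK (T + S) = starOp hK T + starOp hK S := by
  rw [starOp, starOp, starOp, conjOp_add, transposeOp_add]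

/-- `(c T)^* = \bar c T^*`. -/
theorem starOp_smul (c : k) (T : heckeAlgebra k K) : starOp hK (c • T) = star c • starOp hK T := by
  rw [starOp, starOp, conjOp_smul, transposeOp_smul]

/-- `T^{**} = T`. -/
theorem starOp_starOp (T : heckeAlgebra k K) : starOp hK (starOp hK T) = T := by
  rw [starOp, starOp, ← conjOp_transposeOp, transposeOp_transposeOp, conjOp_conjOp]

/-- `T_g^* = T_{g⁻¹}`. -/
theorem starOp_doubleCosetOp (g : G) [Finite (MulAction.orbit K (g : G ⧸ K))]
    [Finite (MulAction.orbit K ((g⁻¹ : G) : G ⧸ K))] :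
    starOp hK (doubleCosetOp k K g) = doubleCosetOp k K g⁻¹ := by
  rw [starOp, conjOp_doubleCosetOp, transposeOp_doubleCosetOp]

/-- `H(G, K)` AS A `∗`-RING (Mathlib's `StarRing`): `star T = T^*`, an involutive additive
anti-automorphism — a definition rather than an instance, since it depends on the finiteness
hypothesis `hK`. -/
@[reducible] noncomputable def starRing : StarRing (heckeAlgebra k K) where
  star := starOp hK
  star_involutive := starOp_starOp hK
  star_mul := starOp_mul hK
  star_add := starOp_add hK

end Star

end Summit.Ventures.HodgeRepro2.T5HeckeStar
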